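import Mathlib
import HarnessLib
import Summits.AtomisticToContinuum.Crystallization.Theorems.PricedLinkCensusSoftLayerPropagationOneStackingMapSearchDefs
import Summits.AtomisticToContinuum.Crystallization.Theorems.PricedLinkCensusSoftLayerPropagationOneStackingMapSearchLeaf
import Summits.AtomisticToContinuum.Crystallization.Theorems.PricedLinkCensusSoftLayerPropagationOneStackingMapCompletions
import Summits.AtomisticToContinuum.Crystallization.Theorems.PricedLinkCensusSoftLayerPropagationOneStackingMapRealizes
import Summits.AtomisticToContinuum.Crystallization.Theorems.PricedLinkCensusSoftLayerPropagationOneStackingMapStep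
import Summits.AtomisticToContinuum.Crystallization.Theorems.PricedLinkCensusSoftLayerPropagationOneStackingMapLeafSound

/-!
# One-stacking map engine: soundness of the search, of its frontier and of the parts

Route `PricedLinkCensus`, crux `SoftLayerPropagation` (stmt-AtomisticToContinuum-14233), line
`Sketch`, stub `stub_oneStackingMap`.  **`search_sound`**: `St.search TABLE fuel s = true` for a
realized state forces `Dev.Concl` (induction on the fuel: `options_sound` at an inner node,
`leaf_sound` at a leaf).  **`frontier_sound`**: some state of the depth-`d` frontier (`d ≤ 5`) of a
realized state is realized.  **`checkParts_sound`**: if every round-robin part of the search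
below the frontier of the root returns `true`, then every development satisfies `Dev.Concl`.
All [folklore].
-/

noncomputable section

namespace Summit.AtomisticToContinuum.Crystallization.Theorems

namespace OneStacking

open V3

variable (A : Dev)

/-- **Soundness of the search.** [folklore] -/
theorem search_sound : ∀ (fuel : ℕ) (s : St) (emb : ℕ → Fin A.N), RealizedBy A s emb →
    St.search TABLE fuel s = true → Nonempty A.Concl := by
  intro fuel
  induction fuel with
  | zero => intro s emb _ h; simp [St.search] at h
  | succ fuel ih =>
    intro s emb hR h
    rw [St.search] at h
    split_ifs at h with hc
    · cases ho : s.options TABLE with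
      | none => rw [ho] at h; exact Bool.noConfusion h
      | some opts =>
        rw [ho] at h
        simp only [List.all_eq_true] at h
        obtain ⟨s', hs', emb', ⟨hR'⟩⟩ := options_sound hR hc.1 hc.2 ho
        exact ih s' emb' hR' (h s' hs')
    · exact leaf_sound hR hc h

/-- **Soundness of the frontier** (depth `d ≤ 5`). [folklore] -/
theorem frontier_sound {d : ℕ} (hd : d ≤ 5) : ∀ (fuel : ℕ) (s : St) (emb : ℕ → Fin A.N), RealizedBy A s emb →
    ∀ fr : List St, St.frontier TABLE fuel d s = some fr → ∃ s' ∈ fr, ∃ emb' : ℕ → Fin A.N, Nonempty (RealizedBy A s' emb') := by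
  intro fuel
  induction fuel with
  | zero => intro s emb _ fr h; simp [St.frontier] at h
  | succ fuel ih =>
    intro s emb hR fr h
    rw [St.frontier] at h
    split_ifs at h with hc
    · cases ho : s.options TABLE with
      | none => simp [ho] at h
      | some opts =>
        simp only [ho, Option.map_eq_some_iff] at h
        obtain ⟨frs, hfrs, rfl⟩ := h
        obtain ⟨s', hs', emb', ⟨hR'⟩⟩ := options_sound hR hc.1 (by omega) ho
        obtain ⟨fr', hfr', hsfr⟩ := exists_mem_of_mapM_eq_some hfrs hs'
        obtain ⟨s'', hs'', emb'', hR''⟩ := ih s' emb' hR' fr' hsfr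
        exact ⟨s'', List.mem_flatten.2 ⟨fr', hfr', hs''⟩, emb'', hR''⟩
    · simp only [Option.some.injEq] at h
      subst h
      exact ⟨s, List.mem_singleton_self _, emb, ⟨hR⟩⟩

/-- **Soundness of the parts**: if every part returns `true` (depth `d ≤ 5`, `parts > 0`), every
development satisfies the one-stacking conclusion. [folklore] -/
theorem checkParts_sound {d parts fuel : ℕ} (hd : d ≤ 5) (hp : 0 < parts)
    (h : ∀ idx, idx < parts → St.checkPart d parts idx fuel = true) : Nonempty A.Concl := by
  have h0 := h 0 hp
  -- the frontier of the root
  cases hfr : St.frontier TABLE 4000 d St.root with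
  | none => simp [St.checkPart, hfr] at h0
  | some fr =>
    obtain ⟨s', hs', emb', ⟨hR'⟩⟩ := frontier_sound A hd 4000 St.root (fun _ => A.i) (realizedByRoot A) fr hfr
    obtain ⟨t, ht, rfl⟩ := List.mem_iff_getElem.1 hs'
    have hpart := h (t % parts) (Nat.mod_lt t hp)
    simp only [St.checkPart, hfr, List.all_eq_true, List.mem_filter, List.mem_range, decide_eq_true_eq] at hpart
    have := hpart t ⟨ht, rfl⟩
    rw [List.getElem?_eq_getElem ht] at this
    exact search_sound A fuel _ emb' hR' this

end OneStacking

end Summit.AtomisticToContinuum.Crystallization.Theorems
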